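import Summits.HodgeConjecture.HodgeConjecture.Theses.EndoscopicMiddleDegree
import Literature.AlgebraicGeometry.HodgeTheory.LefschetzOneOne
import Literature.AlgebraicGeometry.HodgeTheory.HodgeIndexSurface
import Literature.AlgebraicGeometry.HodgeTheory.HodgeClassesCupPairing

/-!
# Sketch (ideator 2, crux `IsotypicMiddleClassesAlgebraic`, round 1): first lemmas of two lines

Only ELABORATION is claimed here (crux-ideate stage: no skeleton, no proofs).
`corrAction` is verbatim the action `P` of the crux decl
`Summit.HodgeConjecture.HodgeConjecture.Theses.EndoscopicMiddleDegree.IsotypicMiddleClassesAlgebraic`.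
-/

set_option linter.dupNamespace false

noncomputable section

open CategoryTheory
open Literature.AlgebraicGeometry
open Literature.AlgebraicGeometry.HodgeTheory
open Literature.AlgebraicGeometry.ShimuraVarieties
open Literature.AlgebraicTopology.SingularHomology (cupProduct)

namespace Summit.HodgeConjecture.HodgeConjecture.Cruxes.IsotypicMiddleClassesAlgebraic.IdeatorTwo

/-- The correspondence action `P_γ β = pr₁₊(pr₂^* β ∪ γ)` of the crux, packaged. -/
def corrAction (μ : OrientationFamily) {m : ℕ} {X : Motives.SchemeOver ℂ}
    (D : UnitaryBallQuotientDatum (2 * (m + 1)) X)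
    (γ : complexBetti (MonoidalCategoryStruct.tensorObj X X) (2 * (2 * (m + 1)))) :
    complexBetti X (2 * (m + 1)) → complexBetti X (2 * (m + 1)) := fun β =>
  complexGysin μ (Motives.IsSmoothProjective.tensor_holds D.isSmoothProjective D.isSmoothProjective)
    D.isSmoothProjective (CartesianMonoidalCategory.fst X X)
    (show 2 * (m + 1) + 2 * (2 * (m + 1)) + 2 * (2 * (m + 1)) = 2 * (m + 1) + 2 * (2 * (m + 1) + 2 * (m + 1)) by ring)
    (cupProduct (rfl : 2 * (m + 1) + 2 * (2 * (m + 1)) = 2 * (m + 1) + 2 * (2 * (m + 1)))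
      (complexBetti.map (CartesianMonoidalCategory.snd X X) (2 * (m + 1)) β) γ)

/-- The fixed rational classes of `P`: the ℚ-piece `W(P) = {c rational | P c = c}`. -/
def fixedRational (μ : OrientationFamily) {m : ℕ} {X : Motives.SchemeOver ℂ}
    (D : UnitaryBallQuotientDatum (2 * (m + 1)) X)
    (γ : complexBetti (MonoidalCategoryStruct.tensorObj X X) (2 * (2 * (m + 1)))) :
    Set (complexBetti X (2 * (m + 1))) :=
  {c | IsRationalClass c ∧ corrAction μ D γ c = c}

/-! ## Line A (delta-prime seed swap): typed first lemma = ONE SEED PER TRANSITIVE PIECE SUFFICES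

The lever itself (move the supersingular seed prime to a δ-place of the ε-negative CAP packet, where
Mœglin's two-element local packet lets the Rapoport–Zink cohomology swap `J ↔ δ` and compensate the
archimedean twin sign) is automorphic and not typable today; its first CHECKABLE consequence on the
Betti side is that a single algebraic seed in a piece on which algebraic self-correspondences act
transitively makes the whole piece algebraic. -/

/-- `OneSeedSuffices m`: for data as in the crux, if algebraic self-correspondence classes act
TRANSITIVELY on the non-zero fixed rational classes of `P` (Hecke simplicity of an isotypic piece),
then one non-zero algebraic fixed rational class forces every fixed rational class to be algebraic. -/
def OneSeedSuffices (m : ℕ) : Prop :=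
  ∀ (μ : OrientationFamily), μ.HasPoincareDuality →
  ∀ (X : Motives.SchemeOver ℂ) (D : UnitaryBallQuotientDatum (2 * (m + 1)) X)
    (γ : complexBetti (MonoidalCategoryStruct.tensorObj X X) (2 * (2 * (m + 1)))),
    γ ∈ algebraicClasses (MonoidalCategoryStruct.tensorObj X X) (2 * (m + 1)) →
    -- transitivity of algebraic correspondences on the piece (Hecke simplicity, informal crux B0)
    (∀ w ∈ fixedRational μ D γ, w ≠ 0 → ∀ c ∈ fixedRational μ D γ,
        ∃ τ ∈ algebraicClasses (MonoidalCategoryStruct.tensorObj X X) (2 * (m + 1)),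
          corrAction μ D τ w = c) →
    (∃ w ∈ fixedRational μ D γ, w ≠ 0 ∧ w ∈ algebraicClasses X (m + 1)) →
    ∀ c ∈ fixedRational μ D γ, c ∈ algebraicClasses X (m + 1)

/-- The only geometric input of `OneSeedSuffices`: algebraic correspondences preserve algebraic
classes (cup product of algebraic classes is algebraic + Gysin of algebraic is algebraic). -/
def CorrActionPreservesAlgebraic (m : ℕ) : Prop :=
  ∀ (μ : OrientationFamily), μ.HasPoincareDuality →
  ∀ (X : Motives.SchemeOver ℂ) (D : UnitaryBallQuotientDatum (2 * (m + 1)) X)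
    (τ : complexBetti (MonoidalCategoryStruct.tensorObj X X) (2 * (2 * (m + 1)))),
    τ ∈ algebraicClasses (MonoidalCategoryStruct.tensorObj X X) (2 * (m + 1)) →
    ∀ z ∈ algebraicClasses X (m + 1), corrAction μ D τ z ∈ algebraicClasses X (m + 1)

/-- `OneSeedSuffices` is pure logic on top of `CorrActionPreservesAlgebraic`. -/
theorem oneSeedSuffices_of (m : ℕ) (h : CorrActionPreservesAlgebraic m) : OneSeedSuffices m := by
  intro μ hμ X D γ _hγ htrans hseed c hc
  obtain ⟨w, hw, hw0, hwalg⟩ := hseed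
  obtain ⟨τ, hτ, rfl⟩ := htrans w hw hw0 c hc
  exact h μ hμ X D τ hτ w hwalg

/-! ## Line B (Hodge-index left inverse): incidence transport to divisor classes of a parameter
variety, and the transfer `TateConiveau` -/

/-- The incidence map `Φ_* : H^{2(m+1)}(X) → H²(F)`, `Φ_* c = pr_{F*}(pr_X^* c ∪ Φ)`, of a class
`Φ` of codimension `m + 2` on `X × F` (the universal family of `m`-folds of `X` parametrised by the
smooth projective `d`-fold `F`). -/
def incidence (μ : OrientationFamily) {m d : ℕ} {X F : Motives.SchemeOver ℂ}
    (hX : Motives.IsSmoothProjective (2 * (m + 1)) X) (hF : Motives.IsSmoothProjective d F)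
    (Φ : complexBetti (MonoidalCategoryStruct.tensorObj X F) (2 * (m + 2))) :
    complexBetti X (2 * (m + 1)) → complexBetti F (2 * 1) := fun c =>
  complexGysin μ (Motives.IsSmoothProjective.tensor_holds hX hF) hF (CartesianMonoidalCategory.snd X F)
    (show 2 * (m + 1) + 2 * (m + 2) + 2 * d = 2 * 1 + 2 * (2 * (m + 1) + d) by ring)
    (cupProduct (rfl : 2 * (m + 1) + 2 * (m + 2) = 2 * (m + 1) + 2 * (m + 2))
      (complexBetti.map (CartesianMonoidalCategory.fst X F) (2 * (m + 1)) c) Φ)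

/-- FIRST LEMMA of line B (`IncidenceIsDivisorial m`): for an ALGEBRAIC incidence class `Φ`, the
incidence image of a rational Hodge `(m+1,m+1)`-class is a rational `(1,1)`-class on `F` — hence a
divisor class by Lefschetz `(1,1)` (`lefschetzOneOne_rational`), with NO Hodge conjecture on `F`.
This is where the Tate-type hypothesis of the crux pays: the whole piece `Im P` lands in `NS(F)_ℚ`. -/
def IncidenceIsDivisorial (m : ℕ) : Prop :=
  ∀ (μ : OrientationFamily), μ.HasPoincareDuality →
  ∀ (X : Motives.SchemeOver ℂ) (D : UnitaryBallQuotientDatum (2 * (m + 1)) X)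
    (d : ℕ) (F : Motives.SchemeOver ℂ) (hF : Motives.IsSmoothProjective d F)
    (Φ : complexBetti (MonoidalCategoryStruct.tensorObj X F) (2 * (m + 2))),
    Φ ∈ algebraicClasses (MonoidalCategoryStruct.tensorObj X F) (m + 2) →
    ∀ c : complexBetti X (2 * (m + 1)), IsRationalClass c →
      IsOfHodgeType (2 * (m + 1)) X (2 * (m + 1)) (m + 1) (m + 1) c →
      IsRationalClass (incidence μ D.isSmoothProjective hF Φ c) ∧
        IsOfHodgeType d F (2 * 1) 1 1 (incidence μ D.isSmoothProjective hF Φ c)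

/-- TRANSFER `C⁺` of line B (`TateConiveau m`): every rational class fixed by a `P` with purely
`(m+1,m+1)` image is the Gysin image of a rational `(1,1)`-class on a smooth projective
`(m+2)`-fold mapping to `X` — coniveau `m` realised with a DIVISOR-class residue (m = 1: supported on
a threefold; m = 2: on a fourfold inside the sixfold). Strictly between the crux and nothing: it is
implied by the crux (take the desingularised cycle) and implies it by Lefschetz `(1,1)` + Gysin. -/
def TateConiveau (m : ℕ) : Prop :=
  ∀ (μ : OrientationFamily), μ.HasPoincareDuality →
  ∀ (X : Motives.SchemeOver ℂ) (D : UnitaryBallQuotientDatum (2 * (m + 1)) X)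
    (γ : complexBetti (MonoidalCategoryStruct.tensorObj X X) (2 * (2 * (m + 1)))),
    γ ∈ algebraicClasses (MonoidalCategoryStruct.tensorObj X X) (2 * (m + 1)) →
    (∀ β, IsRationalClass β → IsRationalClass (corrAction μ D γ β)) →
    (∀ β, IsOfHodgeType (2 * (m + 1)) X (2 * (m + 1)) (m + 1) (m + 1) (corrAction μ D γ β)) →
    ∀ c, IsRationalClass c → corrAction μ D γ c = c →
      ∃ (T : Motives.SchemeOver ℂ) (hT : Motives.IsSmoothProjective (m + 2) T) (f : T ⟶ X)
        (a : complexBetti T (2 * 1)), IsRationalClass a ∧ IsOfHodgeType (m + 2) T (2 * 1) 1 1 a ∧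
        complexGysin μ hT D.isSmoothProjective f
          (show 2 * 1 + 2 * (2 * (m + 1)) = 2 * (m + 1) + 2 * (m + 2) by ring) a = c

/-- The ENGINE of line B (`HodgeIndexLeftInverse m`): if some algebraic incidence class `Φ` on
`X × F` is injective on the fixed rational classes of `P` MODULO the primitive correction (here:
injective outright and avoiding the ample line `ℂ·ℓ`), then every fixed rational class is
algebraic. Proof on paper: `R = ᵗΦ₀ ∘ (ℓ^{d-2} ∪ ·) ∘ Φ₀` is an algebraic, cup-self-adjoint
endomorphism of `H^{2(m+1)}(X,ℚ)`, negative semi-definite on real Hodge classes by the Hodge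
index theorem on `H^{1,1}(F)`, with `R(Hdg_ℚ) ⊆ Alg` by Lefschetz `(1,1)` on `F`; self-adjointness
on the non-degenerate space `Hdg_ℚ` (`hodgeClasses_cupPairing_nondegenerate`) gives
`(ker Φ₀|Hdg)^⊥ = Im R ⊆ Alg`. Stated as the implication it delivers. -/
def HodgeIndexLeftInverse (m : ℕ) : Prop :=
  ∀ (μ : OrientationFamily), μ.HasPoincareDuality →
  ∀ (X : Motives.SchemeOver ℂ) (D : UnitaryBallQuotientDatum (2 * (m + 1)) X)
    (γ : complexBetti (MonoidalCategoryStruct.tensorObj X X) (2 * (2 * (m + 1)))),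
    γ ∈ algebraicClasses (MonoidalCategoryStruct.tensorObj X X) (2 * (m + 1)) →
    (∀ β, IsRationalClass β → IsRationalClass (corrAction μ D γ β)) →
    (∀ β, IsOfHodgeType (2 * (m + 1)) X (2 * (m + 1)) (m + 1) (m + 1) (corrAction μ D γ β)) →
    hodgeClasses_cupPairing_nondegenerate (2 * (m + 1)) X →
    (∃ (d : ℕ) (F : Motives.SchemeOver ℂ) (hF : Motives.IsSmoothProjective d F)
        (Φ : complexBetti (MonoidalCategoryStruct.tensorObj X F) (2 * (m + 2)))
        (ℓ : complexBetti F (2 * 1)),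
        Φ ∈ algebraicClasses (MonoidalCategoryStruct.tensorObj X F) (m + 2) ∧
        ℓ ∈ algebraicClasses F 1 ∧ 2 ≤ d ∧
        -- SWEEP: the incidence map is injective on the fixed rational classes and misses `ℂ·ℓ`
        (∀ c ∈ fixedRational μ D γ, ∀ t : ℂ,
          incidence μ D.isSmoothProjective hF Φ c = t • ℓ → c = 0)) →
    ∀ c ∈ fixedRational μ D γ, c ∈ algebraicClasses X (m + 1)

/-- Bookkeeping: the engine, granted for `m ∈ {1,2}`, is literally the crux restricted to data
admitting a sweeping family — so the LINE is: (sweep exists for every `(X, D, P)`) + engine ⟹ crux. -/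
def SweepExists (m : ℕ) : Prop :=
  ∀ (μ : OrientationFamily), μ.HasPoincareDuality →
  ∀ (X : Motives.SchemeOver ℂ) (D : UnitaryBallQuotientDatum (2 * (m + 1)) X)
    (γ : complexBetti (MonoidalCategoryStruct.tensorObj X X) (2 * (2 * (m + 1)))),
    γ ∈ algebraicClasses (MonoidalCategoryStruct.tensorObj X X) (2 * (m + 1)) →
    (∀ β, IsRationalClass β → IsRationalClass (corrAction μ D γ β)) →
    (∀ β, IsOfHodgeType (2 * (m + 1)) X (2 * (m + 1)) (m + 1) (m + 1) (corrAction μ D γ β)) →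
    ∃ (d : ℕ) (F : Motives.SchemeOver ℂ) (hF : Motives.IsSmoothProjective d F)
      (Φ : complexBetti (MonoidalCategoryStruct.tensorObj X F) (2 * (m + 2)))
      (ℓ : complexBetti F (2 * 1)),
      Φ ∈ algebraicClasses (MonoidalCategoryStruct.tensorObj X F) (m + 2) ∧
      ℓ ∈ algebraicClasses F 1 ∧ 2 ≤ d ∧
      (∀ c ∈ fixedRational μ D γ, ∀ t : ℂ,
        incidence μ D.isSmoothProjective hF Φ c = t • ℓ → c = 0)

/-- Line B closes the crux from its two stubs and the non-degeneracy fact (pure logic; the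
non-degeneracy of the cup pairing on Hodge classes is the tree's named fact, supplied per `X`). -/
theorem crux_of_lineB
    (hND : ∀ (m : ℕ) (X : Motives.SchemeOver ℂ),
      Nonempty (UnitaryBallQuotientDatum (2 * (m + 1)) X) →
        hodgeClasses_cupPairing_nondegenerate (2 * (m + 1)) X)
    (hE : ∀ m, 1 ≤ m → m ≤ 2 → HodgeIndexLeftInverse m)
    (hS : ∀ m, 1 ≤ m → m ≤ 2 → SweepExists m) :
    Summit.HodgeConjecture.HodgeConjecture.Theses.EndoscopicMiddleDegree.IsotypicMiddleClassesAlgebraic := by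
  intro μ hμ m X D h1 h2 γ hγ P hPrat hPhdg c hc hPc
  have hsweep := hS m h1 h2 μ hμ X D γ hγ hPrat hPhdg
  exact hE m h1 h2 μ hμ X D γ hγ hPrat hPhdg (hND m X ⟨D⟩) hsweep c ⟨hc, hPc⟩

end Summit.HodgeConjecture.HodgeConjecture.Cruxes.IsotypicMiddleClassesAlgebraic.IdeatorTwo

end
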